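import Mathlib
import Summits.Ventures.HodgeRepro.Tier4.Line4.LevelVolume

/-!
# Tier4/Line4/LevelVolumeAlong — the dimension-count display ALONG THE POWERS OF ONE PRIME (the honest shape), and the
`L¹` clause of the natural witness along that family

Blind re-derivation cell `pub-hodge-repro`, Tier 4 «prove the step» (README §9–§10), seat t4-L2-p1 (gen 3; L4 service
prover; the finding S15079 on my own `LevelVolumeComparison`, LevelVolume p702383).  Tree path
`lean/Summits/Ventures/HodgeRepro/Tier4/Line4/LevelVolumeAlong.lean`.  Imports `Line4/LevelVolume`.  Mathlib-level; no
literature.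

THE FINDING (S15079; crit-1 g9's precision S15081 / Entry 125 S15083 taken).  `LevelVolumeComparison` as landed
quantifies over EVERY level `N ≠ 0`.  With `vol(K(1)) = vol(T_f ∩ K(1)) = vol(T′_f ∩ K(1)) = 1` and Hensel-surjective
reductions, `vol_G(K(N)) = |G(𝓞/N)|⁻¹` and `vol_T(T_f ∩ K(N)) = |T(𝓞/N)|⁻¹`, so the ratio
`vol_G(K(N)) / (vol_T(T_f ∩ K(N)) · vol_{T′}(T′_f ∩ K(N)))` is the Euler product over `p ∣ N` of
`|T(𝔽_p)| |T′(𝔽_p)| / |G(𝔽_p)|` (the `p^{4f(n−1)}` of the lifts cancel against `p^{2f(n−1)} · p^{2f(n−1)}` — the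
«dimension count» `4 = 2 + 2`); at a place where both tori are INERT (`|U(1)(𝔽_q)| = q + 1`,
`|U₂(𝔽_q)| = q⁴(1 + q⁻¹)(1 − q⁻²)`) the factor is `(1 + q⁻¹)²/(1 − q⁻¹) = 1 + 3/q + O(q⁻²)`, at a split place
`(1 − q⁻¹)²/(1 + q⁻¹) = 1 − 3/q + O(q⁻²)`: the product is UNBOUNDED along `N` with many inert prime factors, so NO
constant `M` serves every `N` — the `∀ N` display is expected FALSE (O-L4-LEVELVOL, conceded by the author).  Along the
powers `q^n` of ONE prime the ratio is the single local factor at `q`, constant in `n`, and for `q ∤ disc · den(γ₀)` the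
element `γ₀,f` normalises `K_q(q^n)` so that the double-coset index `[K(q^n) : K(q^n) ∩ γ₀,f K(q^n) γ₀,f⁻¹]` is bounded in
`n` — THAT is the shape Hensel's lift supports (lead (R-28)(b) S15087: the level family of (7b)/(8′) is indexed along `q^n`;
the main term `re_setIntegral_chi_innerFin_ffinLevel_ge` holds at every level and is untouched).

THE STATEMENTS.  `LevelVolumeComparisonAlong W νf νf' γ₀ μfin q` — the display along `q^n` — and its corollary
`integral_norm_ffinLevel_le_along`: `∃ M, ∀ n, ∫_{G(𝔸_f)} ‖ffinLevel (q^n)‖ dμ_f ≤ M`, the `L¹` clause of the MIXED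
normalisation clause (crit-1 Entry 119) on the natural witness along the family.  `LevelVolumeComparison` (the `∀ N` form)
implies the along-form for every `q ≠ 0` (`levelVolumeComparisonAlong_of_levelVolumeComparison`), recorded so that the two
Props are comparable; nothing is asserted about either.

Nothing here says anything about the status of the Hodge conjecture for CM abelian varieties, which is NOT proved
(HC_CM is NOT proved by anyone in this repository).
-/

set_option autoImplicit false
noncomputable section
namespace Summit.Ventures.HodgeRepro.Tier4.Line4
open Summit.Ventures.HodgeRepro.Tier4 Summit.Ventures.HodgeRepro.Tier4.Common
  Summit.Ventures.HodgeRepro.Tier4.Line1 MeasureTheory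
open scoped ComplexConjugate Topology Pointwise NNReal ENNReal

section Along
variable {k : Type} [Field k] [NumberField k] (W : PlaneData k) [MeasurableSpace (GA W)]
  (νf : Measure (torusFin W)) (νf' : Measure (torusFin' W)) (γ₀ : GA W) (μfin : Measure (finitePart W))

/-- **THE DIMENSION COUNT ALONG THE POWERS OF ONE PRIME (display)** — the honest shape of crit-1 Entry 119's count lemma
(S15079): for a Haar measure `μ_f` on `G(𝔸_f)` and a fixed `q`, the measure of the double coset `K(q^n) γ₀,f K(q^n)` is at
most a constant times `ν_f(T_f ∩ K(q^n)) · ν′_f(T′_f ∩ K(q^n))`, uniformly in `n`.  WHY IT IS EXPECTED TRUE (and not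
proved here — an arithmetic count lemma to land): Hensel's lift at the one prime `q` gives
`vol(K(q^n)) / (vol(T_f ∩ K(q^n)) vol(T′_f ∩ K(q^n))) = |T(𝔽_q)| |T′(𝔽_q)| / |G(𝔽_q)|`, constant in `n`, and for
`q ∤ disc · den(γ₀)` the finite part `γ₀,f` normalises `K_q(q^n)`, so the double-coset index
`[K(q^n) : K(q^n) ∩ γ₀,f K(q^n) γ₀,f⁻¹]`, hence `vol(K(q^n) γ₀,f K(q^n)) / vol(K(q^n))`, is bounded in `n`. -/
def LevelVolumeComparisonAlong (q : ℕ) : Prop :=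
  ∃ M : ℝ, ∀ n : ℕ,
    (μfin {g : finitePart W | (g : GA W) ∈ levelDoubleCoset W (q ^ n) (GA.ofFinPart W γ₀)}).toReal ≤
      M * levelNorm W νf νf' (q ^ n)

/-- The `∀ N` form implies the along-form for every `q ≠ 0` (`q ^ n ≠ 0`). -/
theorem levelVolumeComparisonAlong_of_levelVolumeComparison {q : ℕ} (hq : q ≠ 0)
    (h : LevelVolumeComparison W νf νf' γ₀ μfin) : LevelVolumeComparisonAlong W νf νf' γ₀ μfin q := by
  obtain ⟨M, hM⟩ := h
  exact ⟨M, fun n => hM (q ^ n) (pow_ne_zero n hq)⟩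

/-- **The `L¹` clause on the natural witness along the family**: under the along-display,
`∫_{G(𝔸_f)} ‖ffinLevel (q^n)‖ dμ_f ≤ M` uniformly in `n` (`q ≠ 0`). -/
theorem integral_norm_ffinLevel_le_along [BorelSpace (GA W)] [νf.IsHaarMeasure] [νf'.IsHaarMeasure]
    {q : ℕ} (hq : q ≠ 0) (h : LevelVolumeComparisonAlong W νf νf' γ₀ μfin q) :
    ∃ M : ℝ, ∀ n : ℕ, ∫ g : finitePart W, ‖ffinLevel W νf νf' γ₀ (q ^ n) (g : GA W)‖ ∂μfin ≤ M := by
  haveI : T2Space (GA W) := t2Space_GA W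
  haveI : BorelSpace (finitePart W) := Subtype.borelSpace _
  obtain ⟨M, hM⟩ := h
  refine ⟨M, fun n => ?_⟩
  have hN : q ^ n ≠ 0 := pow_ne_zero n hq
  have hpos := levelNorm_pos W νf νf' hN
  have hmeas : MeasurableSet {g : finitePart W | (g : GA W) ∈ levelDoubleCoset W (q ^ n) (GA.ofFinPart W γ₀)} :=
    ((isCompact_levelDoubleCoset W hN _).isClosed.preimage continuous_subtype_val).measurableSet
  have hfun : (fun g : finitePart W => ‖ffinLevel W νf νf' γ₀ (q ^ n) (g : GA W)‖) =
      {g : finitePart W | (g : GA W) ∈ levelDoubleCoset W (q ^ n) (GA.ofFinPart W γ₀)}.indicator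
        (fun _ => (levelNorm W νf νf' (q ^ n))⁻¹) := by
    funext g
    by_cases hg : (g : GA W) ∈ levelDoubleCoset W (q ^ n) (GA.ofFinPart W γ₀)
    · rw [Set.indicator_of_mem (show g ∈ {g : finitePart W |
          (g : GA W) ∈ levelDoubleCoset W (q ^ n) (GA.ofFinPart W γ₀)} from hg),
        ffinLevel_of_mem W νf νf' γ₀ (q ^ n) g.2 hg, Complex.norm_real, Real.norm_eq_abs,
        abs_of_nonneg (inv_pos.2 hpos).le]
    · rw [Set.indicator_of_notMem (show g ∉ {g : finitePart W |
          (g : GA W) ∈ levelDoubleCoset W (q ^ n) (GA.ofFinPart W γ₀)} from hg)]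
      have h0 : ffinLevel W νf νf' γ₀ (q ^ n) (g : GA W) = 0 := by
        by_contra h0
        exact hg (mem_levelDoubleCoset_of_ffinLevel_ne_zero W νf νf' γ₀ (q ^ n) g.2 h0)
      rw [h0, norm_zero]
  rw [hfun, integral_indicator hmeas, setIntegral_const, smul_eq_mul, measureReal_def]
  calc (μfin {g : finitePart W | (g : GA W) ∈ levelDoubleCoset W (q ^ n) (GA.ofFinPart W γ₀)}).toReal *
        (levelNorm W νf νf' (q ^ n))⁻¹
      ≤ M * levelNorm W νf νf' (q ^ n) * (levelNorm W νf νf' (q ^ n))⁻¹ :=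
        mul_le_mul_of_nonneg_right (hM n) (inv_pos.2 hpos).le
    _ = M := mul_inv_cancel_right₀ hpos.ne' M

end Along

end Summit.Ventures.HodgeRepro.Tier4.Line4

end
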